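import Literature.AlgebraicGeometry.Frobenioids.PadicFrobenioidRelCosetBase
import Literature.AlgebraicGeometry.Frobenioids.QuasiTemperoidCosetGaloisDescent
import Literature.AlgebraicGeometry.Frobenioids.PadicKummerGaloisChartCoset
import HarnessLib

/-!
# Frobenioids II, §2 setting p. 17 for a GENERAL `Π → G_{ℚ_p}`: the base field `K = ℚ̄_p^G` of `G = Im(Π)`, and
# the field `K_A = ℚ̄_p^{Im(V)}` of an object `A` (`A_D = Π/V`) of a `p`-adic Frobenioid over `D = B^temp(Π, Π°)⁰`

Mochizuki, *The geometry of Frobenioids II*, Kyushu J. Math. **62** (2008) 401–460, §2 p. 17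
[cite: MochizukiFrdII2008, Def 2.2 p.17]: "`D` is any category `B^temp(Π, Π°)⁰` as in Example 1.3, (iii), where
`Π → Q`, `G_{ℚ_p} ↠ Q` …, and we assume further that the surjection `G_{ℚ_p} ↠ Q` is an isomorphism. Write
`G := Im(Π) ⊆ Q`; `G° := Im(Π°) ⊆ Q`; `E := B^temp(G, G°)⁰`; `K` for the finite extension of `ℚ_p` determined by
the open subgroup `G ⊆ Q`. Thus, we have a natural functor `D = B^temp(Π, Π°)⁰ → E = B^temp(G, G°)⁰`";
Definition 2.2 p. 17: "`A_D := Base(A) ∈ Ob(D)`; `A_E ∈ Ob(E)` for the projection of `A` to `E`"; Remark 2.2.1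
p. 18: "Write `A_E = Spec(L)` [so `L` is a finite extension of `K`]".

Definitions file (seat abc-iut-L1-t7, gen 5; successor residual of GAP row G-L1t7-α: "general `Π ≠ G_{ℚ_p}` base
chart"). The tree realises `D → D₀` for a general open homomorphism `φ₀ : Π → G_{ℚ_p}` on the SMALL models as
abc-iut-L1-t4's `PadicFrd.relBaseGal p Π° φ₀ hφ₀ : RelCosetCat Π° ⥤ PadicFld p` (`PadicFrobenioidRelCosetBase.lean`:
inclusion into `CosetCat Π`, push-forward `φ₀_*` to `CosetCat (G_{ℚ_p})`, then the Galois-correspondence functor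
`CosetCat.toConnected ⋙ galoisPadicFields p`). Abc-iut-L1-t7 gen 4 built the Definition 2.2 Galois chart for the case
`Π = G_{ℚ_p}` (`PadicKummerGaloisChartCoset.lean`, base field `ℚ_p`). For a general `Π` the base field of the chart
is print's `K = ℚ̄_p^G`, `G = φ₀(Π)` — NOT `ℚ_p` — and this file supplies the field-theoretic layer:

* `imGal` — "`G := Im(Π)`", an open subgroup of `G_{ℚ_p}`; `baseFld` — "`K`", the fixed field `ℚ̄_p^G`
  (finite over `ℚ_p`, `fixingSubgroup_baseFld : Gal(ℚ̄_p/K) = G`); `ℚ̄_p` is an algebraic closure of `K`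
  (`isAlgClosure_baseFld`);
* for an object `A` of a `p`-adic Frobenioid `d` over `hd : d.base = relBaseGal p Π° φ₀ hφ₀` with `A_D = Π/V`:
  `objFld` — the CANONICAL field "`K_A = ℚ̄_p^{φ₀(V)}`" of `A_E = G/φ₀(V)`, an extension of `K` (`objFldK`), finite,
  and normal over `K` when `A_D` is Galois (`V ⊴ Π`, `normal_objFldK`); `objFixFld` — the field the tree's functor
  actually assigns to `A` (`ℚ̄_p^{Stab(x)}` for the chosen base point `x = g₁·φ₀(V)` of the bridge
  `CosetCat.toConnected`, i.e. `g₁ · K_A`), with the identification `twist : objFixFld ≃+* objFldK`, `a ↦ g₁⁻¹ a`;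
* `fieldMap_push_apply` — THE computation behind Def. 2.2 (i) "the functor `C → E` induces `Aut_C(A) → Aut_E(A_E)`":
  the field map of the image in `E` of an endomorphism `h` of `A_D = Π/V` with `h(1·V) = π·V` is `a ↦ (g₁ φ₀(π) g₁⁻¹)·a`
  on `g₁ · K_A`, i.e. `φ₀(π)` on `K_A` — an element of `G`, hence `K`-linear.
The chart itself (`res : Aut_C(A) ↠ Gal(K_A/K)`, the context, Thm. 2.4 (i)) is the sequel file. Classical Galois
theory of `ℚ_p` over Mathlib and landed files; nothing here concerns [IUTchIII]; no statement of the paper is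
strengthened; universe `0` (forced by `PadicFrd.Datum` over `PadicFld.{0}`).
-/

noncomputable section

namespace Literature.AlgebraicGeometry.Frobenioids

namespace PadicFrd

namespace RelGal

open CategoryTheory Opposite Function Field IntermediateField
open Literature.AnabelianGeometry.SemiGraphs QuasiTemperoid

variable (p : ℕ) [Fact p.Prime] {P : Type} [Group P] [TopologicalSpace P]
  (φ₀ : P →* GalFbar ℚ_[p]) (hφ₀ : IsOpenHom φ₀)

/-! ### `G := Im(Π)` and the base field `K = ℚ̄_p^G` -/

/-- **"`G := Im(Π) ⊆ Q`"** (`Q = G_{ℚ_p}`): the image of the open homomorphism `φ₀ : Π → G_{ℚ_p}`, an open subgroup.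
[cite: MochizukiFrdII2008, Def 2.2 p.17] -/
def imGal : OpenSubgroup (GalFbar ℚ_[p]) := CosetCat.mapOpen φ₀ hφ₀.isOpenMap ⊤

/-- Membership in `G = Im(Π)`. [cite: MochizukiFrdII2008, Def 2.2 p.17] -/
theorem mem_imGal {g : GalFbar ℚ_[p]} : g ∈ imGal p φ₀ hφ₀ ↔ ∃ π : P, φ₀ π = g := by
  rw [imGal, CosetCat.mem_mapOpen]
  exact ⟨fun ⟨π, _, h⟩ => ⟨π, h⟩, fun ⟨π, h⟩ => ⟨π, OpenSubgroup.mem_top π, h⟩⟩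

/-- `φ₀ π ∈ G`. [cite: MochizukiFrdII2008, Def 2.2 p.17] -/
theorem map_mem_imGal (π : P) : φ₀ π ∈ imGal p φ₀ hφ₀ := (mem_imGal p φ₀ hφ₀).mpr ⟨π, rfl⟩

/-- **"`K`, the finite extension of `ℚ_p` determined by the open subgroup `G ⊆ Q`"**: the fixed field `ℚ̄_p^G`.
[cite: MochizukiFrdII2008, Def 2.2 p.17] -/
def baseFld : IntermediateField ℚ_[p] (Fbar ℚ_[p]) := fixedField (imGal p φ₀ hφ₀).toSubgroup

/-- `a ∈ K` iff `φ₀(π)·a = a` for all `π ∈ Π`. [cite: MochizukiFrdII2008, Def 2.2 p.17] -/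
theorem mem_baseFld_iff (a : Fbar ℚ_[p]) : a ∈ baseFld p φ₀ hφ₀ ↔ ∀ π : P, φ₀ π a = a := by
  rw [baseFld, IntermediateField.mem_fixedField_iff]
  constructor
  · intro h π
    exact h _ (map_mem_imGal p φ₀ hφ₀ π)
  · intro h g hg
    obtain ⟨π, rfl⟩ := (mem_imGal p φ₀ hφ₀).mp hg
    exact h π

/-- **`Gal(ℚ̄_p/K) = G`** (Krull: `G` is open, hence closed). [cite: MochizukiFrdII2008, Def 2.2 p.17] -/
theorem fixingSubgroup_baseFld : (baseFld p φ₀ hφ₀).fixingSubgroup = (imGal p φ₀ hφ₀).toSubgroup :=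
  haveI : IsGalois ℚ_[p] (Fbar ℚ_[p]) := {}
  InfiniteGalois.fixingSubgroup_fixedField
    ⟨(imGal p φ₀ hφ₀).toSubgroup, Subgroup.isClosed_of_isOpen _ (imGal p φ₀ hφ₀).isOpen⟩

/-- **`K` is finite over `ℚ_p`** (`G` is open; Krull's correspondence, Mathlib `InfiniteGalois.isOpen_iff_finite`).
[cite: MochizukiFrdII2008, Def 2.2 p.17] -/
theorem finiteDimensional_baseFld : FiniteDimensional ℚ_[p] (baseFld p φ₀ hφ₀) := by
  haveI : IsGalois ℚ_[p] (Fbar ℚ_[p]) := {}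
  rw [← InfiniteGalois.isOpen_iff_finite]
  exact Subgroup.isOpen_mono ((IntermediateField.le_iff_le _ _).mp le_rfl) (imGal p φ₀ hφ₀).isOpen

/-- An automorphism of `ℚ̄_p` over `K` is (the image of) an element of `Π`: `Gal(ℚ̄_p/K) = G = φ₀(Π)`.
[cite: MochizukiFrdII2008, Def 2.2 p.17] -/
theorem exists_map_eq_restrictScalars (g : Fbar ℚ_[p] ≃ₐ[baseFld p φ₀ hφ₀] Fbar ℚ_[p]) :
    ∃ π : P, φ₀ π = g.restrictScalars ℚ_[p] := by
  have hg : g.restrictScalars ℚ_[p] ∈ (baseFld p φ₀ hφ₀).fixingSubgroup := by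
    rw [IntermediateField.mem_fixingSubgroup_iff]
    intro x hx
    exact g.commutes (⟨x, hx⟩ : baseFld p φ₀ hφ₀)
  rw [fixingSubgroup_baseFld] at hg
  exact (mem_imGal p φ₀ hφ₀).mp hg

/-- `ℚ̄_p` is Galois over `K`. [cite: MochizukiFrdII2008, Def 2.2 p.17] -/
theorem isGalois_baseFld : IsGalois (baseFld p φ₀ hφ₀) (Fbar ℚ_[p]) :=
  haveI : IsGalois ℚ_[p] (Fbar ℚ_[p]) := {}
  IsGalois.tower_top_of_isGalois ℚ_[p] (baseFld p φ₀ hφ₀) (Fbar ℚ_[p])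

/-- **`ℚ̄_p` is an algebraic closure of `K`** ("`K̄ᵢ` for the algebraic closure of `Kᵢ` used to define the Galois
group `Qᵢ` [so `Gᵢ = Gal(K̄ᵢ/Kᵢ)`]", proof of Thm. 2.4 (ii) p. 20). [cite: MochizukiFrdII2008, Thm 2.4 (ii) p.20] -/
theorem isAlgClosure_baseFld : IsAlgClosure (baseFld p φ₀ hφ₀) (Fbar ℚ_[p]) where
  isAlgClosed := inferInstance
  isAlgebraic := Algebra.IsAlgebraic.tower_top (K := ℚ_[p]) (baseFld p φ₀ hφ₀)

/-- **The identification `K̄ ≅ ℚ̄_p` over `K`** of Mathlib's algebraic closure of `K` (through which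
`G_K := Gal(K̄/K)` of the Definition 2.2 context is read) with `ℚ̄_p` ("`Gᵢ = Gal(K̄ᵢ/Kᵢ)`").
[cite: MochizukiFrdII2008, Thm 2.4 (ii) p.20] -/
def closureEquiv : AlgebraicClosure (baseFld p φ₀ hφ₀) ≃ₐ[baseFld p φ₀ hφ₀] Fbar ℚ_[p] :=
  haveI := isAlgClosure_baseFld p φ₀ hφ₀
  IsAlgClosure.equiv (baseFld p φ₀ hφ₀) (AlgebraicClosure (baseFld p φ₀ hφ₀)) (Fbar ℚ_[p])

/-! ### The field of an object: `A_E = G/φ₀(V)` and `K_A = ℚ̄_p^{φ₀(V)}` -/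

variable {p} {P₀ : OpenSubgroup P}
variable (d : Datum (RelCosetCat P₀) p) (hd : d.base = relBaseGal p P₀ φ₀ hφ₀) (A : d.frobenioid)

/-- **`A_E`, "the projection of `A` to `E`"**: the `G_{ℚ_p}`-set `G_{ℚ_p}/φ₀(V)` for `A_D = Π/V` (push-forward along
`φ₀`; as a `G`-set it is print's `G/φ₀(V) ∈ Ob(E)`). [cite: MochizukiFrdII2008, Def 2.2 p.17] -/
abbrev objCoset : CosetCat (GalFbar ℚ_[p]) := (CosetCat.push φ₀ hφ₀.isOpenMap).obj A.base.obj

/-- `A_E` as a connected object of `B(G_{ℚ_p})` (through the bridge `CosetCat.toConnected`).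
[cite: MochizukiFrdII2008, Def 2.2 p.17] -/
abbrev objConnected : ConnectedPart (BTemp (GalFbar ℚ_[p])) :=
  (CosetCat.toConnected (isTempered_galFbar ℚ_[p])).obj (objCoset φ₀ hφ₀ d A)

/-- The field the base functor ASSIGNS to `A`: `ℚ̄_p^{Stab(x_A)}` for the chosen base point `x_A` of `A_E`
(`= g₁ · K_A`, see `mem_objFixFld_iff`). [cite: MochizukiFrdII2008, Rmk 2.2.1 p.18] -/
abbrev objFixFld : IntermediateField ℚ_[p] (Fbar ℚ_[p]) := fixFld ℚ_[p] (objConnected φ₀ hφ₀ d A)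

/-- The field of `(relBaseGal …).obj A_D` IS `objFixFld` (definitionally). [cite: MochizukiFrdII2008, Rmk 2.2.1 p.18] -/
theorem relBaseGal_obj_K :
    ((relBaseGal p P₀ φ₀ hφ₀).obj A.base).K = ↥(objFixFld φ₀ hφ₀ d A) := rfl

/-- A representative `g₁ ∈ G_{ℚ_p}` of the chosen base point `x_A = g₁·φ₀(V)` of `A_E` exists.
[cite: MochizukiFrdII2008, Rmk 2.2.1 p.18] -/
theorem exists_coe_eq_basePt : ∃ g : GalFbar ℚ_[p],
    (g : (objCoset φ₀ hφ₀ d A).carrier) = basePt (objConnected φ₀ hφ₀ d A) :=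
  QuotientGroup.mk_surjective _

/-- **`g₁`**: a representative of the chosen base point of `A_E`. [cite: MochizukiFrdII2008, Rmk 2.2.1 p.18] -/
def objRep : GalFbar ℚ_[p] := (exists_coe_eq_basePt φ₀ hφ₀ d A).choose

/-- `g₁ · φ₀(V)` is the base point. [cite: MochizukiFrdII2008, Rmk 2.2.1 p.18] -/
theorem objRep_spec : (objRep φ₀ hφ₀ d A : (objCoset φ₀ hφ₀ d A).carrier) =
    basePt (objConnected φ₀ hφ₀ d A) :=
  (exists_coe_eq_basePt φ₀ hφ₀ d A).choose_spec

/-- `a ∈ g₁ · K_A` iff `a` is fixed by `g₁ φ₀(v) g₁⁻¹`, `v ∈ V`. [cite: MochizukiFrdII2008, Rmk 2.2.1 p.18] -/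
theorem mem_objFixFld_iff (a : Fbar ℚ_[p]) : a ∈ objFixFld φ₀ hφ₀ d A ↔
    ∀ v ∈ A.base.obj.sg, (objRep φ₀ hφ₀ d A * φ₀ v * (objRep φ₀ hφ₀ d A)⁻¹) a = a := by
  rw [objFixFld, mem_fixFld_toConnected_iff p _ (objRep_spec φ₀ hφ₀ d A)]
  constructor
  · intro h v hv
    exact h (φ₀ v) ((CosetCat.mem_mapOpen φ₀ hφ₀.isOpenMap).mpr ⟨v, hv, rfl⟩)
  · intro h w hw
    obtain ⟨v, hv, rfl⟩ := (CosetCat.mem_mapOpen φ₀ hφ₀.isOpenMap).mp hw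
    exact h v hv

/-- **`K_A := ℚ̄_p^{φ₀(V)}`**, the field of `A_E = G/φ₀(V)` ("`A_E = Spec(L)` [so `L` is a finite extension of `K`]"),
canonical in `A`. [cite: MochizukiFrdII2008, Rmk 2.2.1 p.18] -/
def objFld : IntermediateField ℚ_[p] (Fbar ℚ_[p]) :=
  fixedField (CosetCat.mapOpen φ₀ hφ₀.isOpenMap A.base.obj.sg).toSubgroup

/-- `a ∈ K_A` iff `φ₀(v)·a = a` for all `v ∈ V`. [cite: MochizukiFrdII2008, Rmk 2.2.1 p.18] -/
theorem mem_objFld_iff (a : Fbar ℚ_[p]) : a ∈ objFld φ₀ hφ₀ d A ↔ ∀ v ∈ A.base.obj.sg, φ₀ v a = a := by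
  rw [objFld, IntermediateField.mem_fixedField_iff]
  constructor
  · intro h v hv
    exact h (φ₀ v) ((CosetCat.mem_mapOpen φ₀ hφ₀.isOpenMap).mpr ⟨v, hv, rfl⟩)
  · intro h w hw
    obtain ⟨v, hv, rfl⟩ := (CosetCat.mem_mapOpen φ₀ hφ₀.isOpenMap).mp hw
    exact h v hv

/-- `K ⊆ K_A`. [cite: MochizukiFrdII2008, Rmk 2.2.1 p.18] -/
theorem baseFld_le_objFld : baseFld p φ₀ hφ₀ ≤ objFld φ₀ hφ₀ d A := by
  intro a ha
  rw [mem_objFld_iff]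
  intro v _
  exact (mem_baseFld_iff p φ₀ hφ₀ a).mp ha v

/-- `K_A` is finite over `ℚ_p` (`φ₀(V)` is open). [cite: MochizukiFrdII2008, Rmk 2.2.1 p.18] -/
theorem finiteDimensional_objFld : FiniteDimensional ℚ_[p] (objFld φ₀ hφ₀ d A) := by
  haveI : IsGalois ℚ_[p] (Fbar ℚ_[p]) := {}
  rw [← InfiniteGalois.isOpen_iff_finite]
  exact Subgroup.isOpen_mono ((IntermediateField.le_iff_le _ _).mp le_rfl)
    (CosetCat.mapOpen φ₀ hφ₀.isOpenMap A.base.obj.sg).isOpen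

/-- For `A_D` Galois (`V ⊴ Π`), `K_A` is stable under `G = φ₀(Π)` (`φ₀(V) ⊴ φ₀(Π)`).
[cite: MochizukiFrdII2008, Def 2.2 (i) p.17] -/
theorem map_mem_objFld (hA : A.base.obj.sg.toSubgroup.Normal) (π : P) {a : Fbar ℚ_[p]}
    (ha : a ∈ objFld φ₀ hφ₀ d A) : φ₀ π a ∈ objFld φ₀ hφ₀ d A := by
  rw [mem_objFld_iff] at ha ⊢
  intro v hv
  have h1 : φ₀ v (φ₀ π a) = φ₀ π (φ₀ (π⁻¹ * v * π) a) := by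
    rw [← AlgEquiv.mul_apply, ← map_mul, ← AlgEquiv.mul_apply, ← map_mul,
      show π * (π⁻¹ * v * π) = v * π by group]
  rw [h1, ha _ (hA.conj_mem' v hv π)]

/-- **`K_A` as an extension of `K`** ("`L` is a finite extension of `K`"). [cite: MochizukiFrdII2008, Rmk 2.2.1 p.18] -/
def objFldK : IntermediateField (baseFld p φ₀ hφ₀) (Fbar ℚ_[p]) := extendScalars (baseFld_le_objFld φ₀ hφ₀ d A)

/-- Membership in `K_A` over `K` is membership in `K_A`. [cite: MochizukiFrdII2008, Rmk 2.2.1 p.18] -/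
theorem mem_objFldK_iff (a : Fbar ℚ_[p]) :
    a ∈ objFldK φ₀ hφ₀ d A ↔ a ∈ objFld φ₀ hφ₀ d A := Iff.rfl

/-- The `ℚ_p`-linear identification of `K_A` over `K` with `K_A`. [cite: MochizukiFrdII2008, Rmk 2.2.1 p.18] -/
def objFldKLinearEquiv : ↥(objFldK φ₀ hφ₀ d A) ≃ₗ[ℚ_[p]] ↥(objFld φ₀ hφ₀ d A) where
  toFun x := ⟨x.1, x.2⟩
  invFun y := ⟨y.1, y.2⟩
  left_inv _ := rfl
  right_inv _ := rfl
  map_add' _ _ := rfl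
  map_smul' _ _ := rfl

/-- **`K_A` is finite over `K`**. [cite: MochizukiFrdII2008, Rmk 2.2.1 p.18] -/
theorem finiteDimensional_objFldK : FiniteDimensional (baseFld p φ₀ hφ₀) (objFldK φ₀ hφ₀ d A) := by
  haveI := finiteDimensional_objFld φ₀ hφ₀ d A
  haveI : FiniteDimensional ℚ_[p] (objFldK φ₀ hφ₀ d A) :=
    LinearEquiv.finiteDimensional (objFldKLinearEquiv φ₀ hφ₀ d A).symm
  exact Module.Finite.of_restrictScalars_finite ℚ_[p] (baseFld p φ₀ hφ₀) _

/-- **For `A_D` Galois, `K_A` is normal over `K`** (`Gal(ℚ̄_p/K) = φ₀(Π)` stabilises `K_A`, so `Gal(ℚ̄_p/K_A)` is normal in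
it; Krull, Mathlib `InfiniteGalois.normal_iff_isGalois`). [cite: MochizukiFrdII2008, Def 2.2 (i) p.17] -/
theorem normal_objFldK (hA : A.base.obj.sg.toSubgroup.Normal) :
    Normal (baseFld p φ₀ hφ₀) (objFldK φ₀ hφ₀ d A) := by
  haveI := isGalois_baseFld p φ₀ hφ₀
  have hn : (objFldK φ₀ hφ₀ d A).fixingSubgroup.Normal := by
    refine ⟨fun n hn g => ?_⟩
    rw [IntermediateField.mem_fixingSubgroup_iff] at hn ⊢
    intro x hx
    obtain ⟨π, hπ⟩ := exists_map_eq_restrictScalars p φ₀ hφ₀ g⁻¹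
    have hgx : g⁻¹ x ∈ objFldK φ₀ hφ₀ d A := by
      rw [mem_objFldK_iff]
      have : g⁻¹ x = φ₀ π x := by
        rw [hπ]; rfl
      rw [this]
      exact map_mem_objFld φ₀ hφ₀ d A hA π ((mem_objFldK_iff φ₀ hφ₀ d A x).mp hx)
    rw [AlgEquiv.mul_apply, AlgEquiv.mul_apply, hn _ hgx, ← AlgEquiv.mul_apply, mul_inv_cancel, AlgEquiv.one_apply]
  haveI := (InfiniteGalois.normal_iff_isGalois _).mp hn
  infer_instance

/-! ### `g₁ · K_A` versus `K_A` -/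

/-- `a ∈ g₁·K_A` iff `g₁⁻¹ a ∈ K_A`. [cite: MochizukiFrdII2008, Rmk 2.2.1 p.18] -/
theorem mem_objFixFld_iff_inv_apply_mem (a : Fbar ℚ_[p]) : a ∈ objFixFld φ₀ hφ₀ d A ↔
    (objRep φ₀ hφ₀ d A)⁻¹ a ∈ objFld φ₀ hφ₀ d A := by
  rw [mem_objFixFld_iff, mem_objFld_iff]
  refine forall_congr' fun v => forall_congr' fun _ => ?_
  constructor
  · intro h
    have h' : (objRep φ₀ hφ₀ d A)⁻¹ ((objRep φ₀ hφ₀ d A * φ₀ v * (objRep φ₀ hφ₀ d A)⁻¹) a) =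
        (objRep φ₀ hφ₀ d A)⁻¹ a := by rw [h]
    rwa [← AlgEquiv.mul_apply, show (objRep φ₀ hφ₀ d A)⁻¹ *
      (objRep φ₀ hφ₀ d A * φ₀ v * (objRep φ₀ hφ₀ d A)⁻¹) = φ₀ v * (objRep φ₀ hφ₀ d A)⁻¹ by group, AlgEquiv.mul_apply] at h'
  · intro h
    rw [AlgEquiv.mul_apply, AlgEquiv.mul_apply, h, ← AlgEquiv.mul_apply, mul_inv_cancel, AlgEquiv.one_apply]

/-- **`g₁ · K_A ≅ K_A`, `a ↦ g₁⁻¹·a`**: the identification of the field assigned to `A` by the base functor with the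
canonical `K_A = ℚ̄_p^{φ₀(V)}` over `K`. [cite: MochizukiFrdII2008, Rmk 2.2.1 p.18] -/
def twist : ↥(objFixFld φ₀ hφ₀ d A) ≃+* ↥(objFldK φ₀ hφ₀ d A) where
  toFun a := ⟨(objRep φ₀ hφ₀ d A)⁻¹ (a : Fbar ℚ_[p]),
    (mem_objFixFld_iff_inv_apply_mem φ₀ hφ₀ d A _).mp a.2⟩
  invFun b := ⟨objRep φ₀ hφ₀ d A (b : Fbar ℚ_[p]),
    (mem_objFixFld_iff_inv_apply_mem φ₀ hφ₀ d A _).mpr (by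
      rw [← AlgEquiv.mul_apply, inv_mul_cancel, AlgEquiv.one_apply]; exact b.2)⟩
  left_inv a := Subtype.ext (by
    change objRep φ₀ hφ₀ d A ((objRep φ₀ hφ₀ d A)⁻¹ (a : Fbar ℚ_[p])) = a
    rw [← AlgEquiv.mul_apply, mul_inv_cancel, AlgEquiv.one_apply])
  right_inv b := Subtype.ext (by
    change (objRep φ₀ hφ₀ d A)⁻¹ (objRep φ₀ hφ₀ d A (b : Fbar ℚ_[p])) = b
    rw [← AlgEquiv.mul_apply, inv_mul_cancel, AlgEquiv.one_apply])
  map_mul' a b := Subtype.ext (map_mul _ _ _)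
  map_add' a b := Subtype.ext (map_add _ _ _)

/-- Values of `twist`. [cite: MochizukiFrdII2008, Rmk 2.2.1 p.18] -/
theorem coe_twist_apply (a : objFixFld φ₀ hφ₀ d A) :
    ((twist φ₀ hφ₀ d A a : objFldK φ₀ hφ₀ d A) : Fbar ℚ_[p]) =
      (objRep φ₀ hφ₀ d A)⁻¹ (a : Fbar ℚ_[p]) := rfl

/-- Values of `twist⁻¹`. [cite: MochizukiFrdII2008, Rmk 2.2.1 p.18] -/
theorem coe_twist_symm_apply (b : objFldK φ₀ hφ₀ d A) :
    (((twist φ₀ hφ₀ d A).symm b : objFixFld φ₀ hφ₀ d A) : Fbar ℚ_[p]) =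
      objRep φ₀ hφ₀ d A (b : Fbar ℚ_[p]) := rfl

/-! ### The field map of an endomorphism of `A_D` -/

/-- **The computation behind "the functor `C → E` induces `Aut_C(A) → Aut_E(A_E)`"**: for an endomorphism `h` of
`A_D = Π/V` with `h(1·V) = π·V`, the field map of its image in `E` (through the base functor of §2) is
`a ↦ (g₁ φ₀(π) g₁⁻¹)·a` on `g₁ · K_A`. [cite: MochizukiFrdII2008, Def 2.2 (i) p.17] -/
theorem fieldMap_push_apply (h : A.base.obj ⟶ A.base.obj) (π : P) (hπ : (π : A.base.obj.carrier) = CosetCat.pt h)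
    (a : objFixFld φ₀ hφ₀ d A) :
    (fieldMap ((CosetCat.toConnected (isTempered_galFbar ℚ_[p])).map ((CosetCat.push φ₀ hφ₀.isOpenMap).map h)) a :
        Fbar ℚ_[p]) =
      (objRep φ₀ hφ₀ d A * φ₀ π * (objRep φ₀ hφ₀ d A)⁻¹) a := by
  have hc : ((φ₀ π : GalFbar ℚ_[p]) : (objCoset φ₀ hφ₀ d A).carrier) =
      CosetCat.pt ((CosetCat.push φ₀ hφ₀.isOpenMap).map h) := by
    rw [CosetCat.pt_push_map, ← hπ, CosetCat.pushQuot_coe]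
  apply fieldMap_apply_of_ρ_eq
  rw [← objRep_spec φ₀ hφ₀ d A, ptMap_toConnected_map_mk p _ hc]
  change (objRep φ₀ hφ₀ d A * φ₀ π * (objRep φ₀ hφ₀ d A)⁻¹) • (objRep φ₀ hφ₀ d A :
      (objCoset φ₀ hφ₀ d A).carrier) = _
  rw [MulAction.Quotient.smul_coe, smul_eq_mul, inv_mul_cancel_right]

/-- … hence on `K_A` (through `twist`) it is **`φ₀(π)` itself** — an element of `G`, so it fixes `K`.
[cite: MochizukiFrdII2008, Def 2.2 (i) p.17] -/
theorem coe_twist_fieldMap_push (h : A.base.obj ⟶ A.base.obj) (π : P) (hπ : (π : A.base.obj.carrier) = CosetCat.pt h)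
    (b : objFldK φ₀ hφ₀ d A) :
    ((twist φ₀ hφ₀ d A (fieldMap ((CosetCat.toConnected (isTempered_galFbar ℚ_[p])).map
        ((CosetCat.push φ₀ hφ₀.isOpenMap).map h)) ((twist φ₀ hφ₀ d A).symm b)) : objFldK φ₀ hφ₀ d A) :
        Fbar ℚ_[p]) = φ₀ π (b : Fbar ℚ_[p]) := by
  rw [coe_twist_apply, fieldMap_push_apply φ₀ hφ₀ d A h π hπ, coe_twist_symm_apply, ← AlgEquiv.mul_apply,
    ← AlgEquiv.mul_apply, show (objRep φ₀ hφ₀ d A)⁻¹ *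
      (objRep φ₀ hφ₀ d A * φ₀ π * (objRep φ₀ hφ₀ d A)⁻¹) * objRep φ₀ hφ₀ d A = φ₀ π by group]

/-! ### The identification `d.fld A_D ≅ g₁ · K_A` carried by `hd` -/

/-- The identification of base objects carried by `hd`. [cite: MochizukiFrdII2008, Def 2.2 p.17] -/
def baseObjIso : d.base.obj A.base ≅ (relBaseGal p P₀ φ₀ hφ₀).obj A.base := eqToIso (by rw [hd])

/-- `d.base.map g` read through the identification (`Functor.congr_hom hd`). [cite: MochizukiFrdII2008, Def 2.2 p.17] -/
theorem base_map_alg (g : A.base ⟶ A.base) (x : d.fld A.base) :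
    (baseObjIso φ₀ hφ₀ d hd A).inv.alg ((d.base.map g).alg x) =
      ((relBaseGal p P₀ φ₀ hφ₀).map g).alg ((baseObjIso φ₀ hφ₀ d hd A).inv.alg x) := by
  rw [Functor.congr_hom hd g, PadicFld.comp_alg, PadicFld.comp_alg, RingHom.comp_apply, RingHom.comp_apply]
  exact PadicFrd.Datum.alg_inv_hom_apply (baseObjIso φ₀ hφ₀ d hd A) _

/-- **`d.fld A_D ≅ g₁ · K_A`** (ring isomorphism carried by `hd`). [cite: MochizukiFrdII2008, Rmk 2.2.1 p.18] -/
def fldEquiv : d.fld A.base ≃+* ↥(objFixFld φ₀ hφ₀ d A) :=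
  { toFun := (baseObjIso φ₀ hφ₀ d hd A).inv.alg
    invFun := (baseObjIso φ₀ hφ₀ d hd A).hom.alg
    left_inv := fun x => PadicFrd.Datum.alg_hom_inv_apply (baseObjIso φ₀ hφ₀ d hd A) x
    right_inv := fun y => PadicFrd.Datum.alg_inv_hom_apply (baseObjIso φ₀ hφ₀ d hd A) y
    map_mul' := fun x y => map_mul _ x y
    map_add' := fun x y => map_add _ x y }

/-- Unfolding `fldEquiv`. [cite: MochizukiFrdII2008, Rmk 2.2.1 p.18] -/
theorem fldEquiv_apply (x : d.fld A.base) : fldEquiv φ₀ hφ₀ d hd A x = (baseObjIso φ₀ hφ₀ d hd A).inv.alg x := rfl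

/-- The field map of `Base(g)` (for `g : A_D → A_D` in `D`, `g(1·V) = π·V`) read in `K_A`: it is `φ₀(π)`.
[cite: MochizukiFrdII2008, Def 2.2 (i) p.17] -/
theorem coe_twist_fldEquiv_base_map (g : A.base ⟶ A.base) (π : P) (hπ : (π : A.base.obj.carrier) = CosetCat.pt g.hom)
    (x : d.fld A.base) :
    ((twist φ₀ hφ₀ d A (fldEquiv φ₀ hφ₀ d hd A ((d.base.map g).alg x)) : objFldK φ₀ hφ₀ d A) : Fbar ℚ_[p]) =
      φ₀ π ((twist φ₀ hφ₀ d A (fldEquiv φ₀ hφ₀ d hd A x) : objFldK φ₀ hφ₀ d A) : Fbar ℚ_[p]) := by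
  rw [fldEquiv_apply, base_map_alg φ₀ hφ₀ d hd A g x, ← coe_twist_fieldMap_push φ₀ hφ₀ d A g.hom π hπ, RingEquiv.symm_apply_apply]
  rfl

end RelGal

end PadicFrd

end Literature.AlgebraicGeometry.Frobenioids

end
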